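/-
Copyright (c) 2026 the pub-hodgecm-mathlib formalisation cell (harness21).  Prover seat hodgecm-mathlib-K2E3-p20 (g5), Track B «K2-LIT» ∕ h413
(`stmt-HodgeConjecture-24833`), line `K2_E3_EllipticInputs`, unit U12 §L, kernel road «RICHARDSON» for (L-B_GL) at `N = 3` (road owner K2E3-p11 (g4)),
brick (R2-Borel), group side: THE BOREL UNIPOTENT ORBITAL MEASURE OF `GL₃(F)` IS CONJUGATION INVARIANT AS A MEASURE.  2026-09-04.
-/
import Literature.NumberTheory.Automorphic.GL3SplitTorusOrbitalIntegral                        -- ★ `exists_lintegral_descConj_diagonal_eq_mul` (Rogawski L. 4.13.1 at a regular diagonal of `GL₃`)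
import Summits.HodgeConjecture.HodgeConjecture.Theorems.K2E3GLnRichardsonMeasureAdInvariant    -- ★ p857336 (K2E3-p11 g4): tube lemma `exists_nhds_one_forall_conj_mem`; brings Levi unimodularity, `G ⧸ A` measures
import Literature.MeasureTheory.Function.AEEqOfCompactOpenSetIntegral                        -- ★ `isTopologicalBasis_setOf_isCompact_isOpen`
import Literature.NumberTheory.Automorphic.CongruenceSubgroupExpansionGL                       -- ★ `nonarchimedeanGroup_gl`
import HarnessLib

/-!
# K2_E3 road (h413), §L — kernel road «RICHARDSON» for (L-B_GL) at `N = 3`, brick (R2-Borel), group side: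
# the Borel unipotent orbital measure `Λ_B = (k u k⁻¹)_* (κ ⊗ μ_N)` of `GL₃(F)` is invariant under conjugation, AS A MEASURE

Cell `pub/hodgecm-mathlib` (D-0151), Track B, seat K2E3-p20 (g5); road owner K2E3-p11 (g4) («(R2-Borel) still open, un-owned», 2026-09-04T04:32Z), §L lead
K2E3-p12 (g4), dealer K2E3-plan (g3).  `--supports stmt-HodgeConjecture-24833 --as helper`; THEOREMS ONLY (no definition ∕ instance ∕ notation ∕ named fact ∕
`sorry`); never imports `Cruxes/…/Lines`.  COUNT-NEUTRAL ((L-B_GL) ∕ (LBGL-ge3) stay OPEN).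

THE MATHEMATICS.  `G = GL₃(F)`, `F` non-archimedean local, `K = GL₃(𝒪)`, `N = N₃ = U_{id}` the upper unitriangular group (THREE blocks — the Borel; the
two-block parabolics are ★ p857336 ∕ p857353, K2E3-p11 (g4)), Haar measures `κ` on `K`, `μ_N` on `N`.  The BOREL UNIPOTENT ORBITAL MEASURE is the push-forward
`Λ := (κ ⊗ μ_N) ∘ (k, u) ↦ k u k⁻¹)⁻¹` on `G` (Deligne–Rao ∕ Richardson measure of the regular unipotent class).  CLAIMS:
* §2 `isFiniteMeasureOnCompacts_map_conj_prod` — `Λ` is finite on compacta (`k u k⁻¹ ∈ C ⇒ u ∈ K⁻¹ C K ∩ N`, compact in `N`);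
* §3 **`GL3.map_conj_borelUnipotentMeasure_eq`** — `(x g x⁻¹)_* Λ = Λ` for every `x ∈ G`.
PROOF of §3, by the road of ★ p857336 (no Iwasawa cocycle, no limit): two measures finite on compacta on the second countable locally compact totally
disconnected `G` agree as soon as they agree on every COMPACT OPEN set (§1 `measure_ext_of_isCompact_isOpen`, π–λ on the compact-open basis ★
`isTopologicalBasis_setOf_isCompact_isOpen`); for a compact open `S` the indicator `𝟙_S` is right-invariant under a neighbourhood `V` of `1` (§1
`exists_nhds_one_forall_mul_mem_iff`), the tube lemma over the compact `K` (★ `exists_nhds_one_forall_conj_mem`) gives `W ∈ 𝓝 1` with `k W k⁻¹ ⊆ V`, and `W`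
contains a REGULAR diagonal `γ = diag(1, 1 + a, 1 + a²)` (§2 `exists_regular_glDiagonal_mem`); then `Λ(S) = ∫ 𝟙_S(k u k⁻¹) = ∫ 𝟙_S(k (u γ) k⁻¹)` (§2
`lintegral_conj_mul_at_eq`), which by ★ Rogawski's descent `exists_lintegral_descConj_diagonal_eq_mul` is `(C ‖Δ(γ)‖⁻¹)⁻¹ ∫_{G ⧸ A} 𝟙_S(y γ y⁻¹) dμ_{G⧸A}` — an
orbital integral, invariant under `S ↦ x⁻¹ S x` (★ invariant Radon measure on `G ⧸ A`, `A` the diagonal torus, ★ `exists_smulInvariantMeasure_integral_fiberIntegral_eq`).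
The Lie-algebra packaging (the regular nilpotent orbit's measure `Λ_J` on `𝔤𝔩₃(F)`, finite on compacta, `Ad`-invariant, carried by `Ad·J`, `≠ 0` — the `Λ_J` of ★
p857363 `gl3_nilpotentStructure_of_orbitMeasures`) is the sequel `K2E3GL3BorelRichardsonMeasure`.
[Rogawski1990, §4.13 Lemma 4.13.1 (a), proof p. 70; §8.1 p. 112]; [HarishChandra1999AdmissibleDistributions, §3 p. 9 (Deligne–Rao)]; [BernsteinZelevinsky1976, §1.1, §1.18].

HONEST LABEL: HC_CM is proved only modulo the 7 printed citations (2 remaining named inputs: hLiu418 = stmt-HodgeConjecture-24832, h413 = stmt-HodgeConjecture-24833)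
until rung 0 closes; count-neutral helper.
-/

set_option autoImplicit false
set_option linter.dupNamespace false   -- `Summit.HodgeConjecture.HodgeConjecture.…` (D-0017 nested layout; lakefile exemption for Summits)

noncomputable section

open MeasureTheory MeasureTheory.Measure Filter Topology Set TopologicalSpace
open scoped MatrixGroups NNReal ENNReal Pointwise
open Literature.NumberTheory.Automorphic Literature.MeasureTheory.Group Literature.MeasureTheory.Function
open Literature.NumberTheory.GaloisRepresentations Literature.NumberTheory.GaloisRepresentations.IsNonarchimedeanLocalField
open Summit.HodgeConjecture.HodgeConjecture.Cruxes.H413.K2E3GLnRichardsonMeasureAdInvariant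

namespace Summit.HodgeConjecture.HodgeConjecture.Cruxes.H413.K2E3GL3BorelUnipotentMeasureConjInvariant

/-! ## §1  Generic: measures agreeing on compact open sets; right-invariance of `𝟙_S` for `S` compact open -/

section Generic

/-- **Two measures agreeing on the compact open sets are equal**, on a second countable Hausdorff Borel space whose compact open sets form a basis,
provided the first is finite on compacta (π–λ: the compact open sets are a π-system generating the Borel σ-algebra; a countable compact-open cover).
[cite: BernsteinZelevinsky1976, §1.1, §1.3] -/
theorem measure_ext_of_isCompact_isOpen {X : Type*} [TopologicalSpace X] [MeasurableSpace X] [BorelSpace X] [T2Space X] [SecondCountableTopology X]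
    (hB : IsTopologicalBasis {C : Set X | IsCompact C ∧ IsOpen C}) (μ ν : Measure X) [IsFiniteMeasureOnCompacts μ]
    (h : ∀ C : Set X, IsCompact C → IsOpen C → μ C = ν C) : μ = ν := by
  have hgen : (‹MeasurableSpace X› : MeasurableSpace X) = MeasurableSpace.generateFrom {C : Set X | IsCompact C ∧ IsOpen C} := by
    rw [BorelSpace.measurable_eq (α := X)]
    exact hB.borel_eq_generateFrom
  have hpi : IsPiSystem {C : Set X | IsCompact C ∧ IsOpen C} := fun s hs t ht _ => ⟨hs.1.inter_right ht.1.isClosed, hs.2.inter ht.2⟩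
  -- a countable cover by compact open sets
  have hcov : ∀ x : X, ∃ C : Set X, (IsCompact C ∧ IsOpen C) ∧ x ∈ C := fun x => by
    obtain ⟨C, hC, hxC, -⟩ := hB.exists_subset_of_mem_open (Set.mem_univ x) isOpen_univ
    exact ⟨C, hC, hxC⟩
  choose C hC hxC using hcov
  obtain ⟨s, hsc, hsU⟩ := TopologicalSpace.countable_cover_nhds (f := C) fun x => (hC x).2.mem_nhds (hxC x)
  refine ext_of_generateFrom_of_cover hgen (hsc.image C) hpi ?_ ?_ ?_ ?_
  · rw [Set.sUnion_image]; exact hsU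
  · rintro _ ⟨x, -, rfl⟩; exact (hC x).1.measure_lt_top.ne
  · rintro _ ⟨x, -, rfl⟩ t ht; exact h _ (ht.1.inter_right (hC x).1.isClosed) (ht.2.inter (hC x).2)
  · rintro _ ⟨x, -, rfl⟩; exact h _ (hC x).1 (hC x).2

/-- **A compact open subset of a topological group is right-invariant under a neighbourhood of `1`**: `∃ V ∈ 𝓝 1, ∀ g, ∀ v ∈ V, g v ∈ S ↔ g ∈ S`
(`S V ⊆ S` for some `V`, Mathlib `compact_open_separated_mul_right`, symmetrised). [cite: BernsteinZelevinsky1976, §1.1] -/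
theorem exists_nhds_one_forall_mul_mem_iff {G : Type*} [Group G] [TopologicalSpace G] [IsTopologicalGroup G] {S : Set G} (hSc : IsCompact S)
    (hSo : IsOpen S) : ∃ V ∈ 𝓝 (1 : G), ∀ g : G, ∀ v ∈ V, (g * v ∈ S ↔ g ∈ S) := by
  obtain ⟨V, hV, hSV⟩ := compact_open_separated_mul_right hSc hSo Subset.rfl
  refine ⟨V ∩ V⁻¹, Filter.inter_mem hV (inv_mem_nhds_one G hV), fun g v hv => ⟨fun hgv => ?_, fun hg => hSV (Set.mul_mem_mul hg hv.1)⟩⟩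
  have h : g * v * v⁻¹ ∈ S := hSV (Set.mul_mem_mul hgv hv.2)
  rwa [mul_inv_cancel_right] at h

/-- The indicator of such an `S` is right-`V`-invariant: `𝟙_S(g v) = 𝟙_S(g)`. [cite: BernsteinZelevinsky1976, §1.1] -/
theorem indicator_mul_eq_of_forall_mul_mem_iff {G : Type*} [Group G] {S V : Set G} (hV : ∀ g : G, ∀ v ∈ V, (g * v ∈ S ↔ g ∈ S)) (g : G) {v : G}
    (hv : v ∈ V) : S.indicator (1 : G → ℝ≥0∞) (g * v) = S.indicator (1 : G → ℝ≥0∞) g := by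
  by_cases hg : g ∈ S
  · rw [Set.indicator_of_mem hg, Set.indicator_of_mem ((hV g v hv).2 hg), Pi.one_apply, Pi.one_apply]
  · rw [Set.indicator_of_notMem hg, Set.indicator_of_notMem fun h => hg ((hV g v hv).1 h)]

end Generic

/-! ## §2  `GL₃(F)`: the map `(k, u) ↦ k u k⁻¹`, finiteness on compacta, regular diagonals near `1`, the average at `γ` -/

section GL3

variable (F : Type*) [Field F] [ValuativeRel F] [TopologicalSpace F] [IsNonarchimedeanLocalField F]
  [MeasurableSpace (GL (Fin 3) F)] [BorelSpace (GL (Fin 3) F)]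

omit [MeasurableSpace (GL (Fin 3) F)] [BorelSpace (GL (Fin 3) F)] in
/-- `(k, u) ↦ k u k⁻¹ : K × N → G` is continuous. [folklore] -/
theorem continuous_conj_prod :
    Continuous fun q : ↥(glInt 3 F) × ↥(unipotentRadicalGL F (id : Fin 3 → Fin 3)) => (q.1 : GL (Fin 3) F) * (q.2 : GL (Fin 3) F) * (q.1 : GL (Fin 3) F)⁻¹ :=
  ((continuous_subtype_val.comp continuous_fst).mul (continuous_subtype_val.comp continuous_snd)).mul (continuous_subtype_val.comp continuous_fst).inv

/-- **`Λ = (k u k⁻¹)_*(κ ⊗ μ_N)` is finite on compacta**: `k u k⁻¹ ∈ C` forces `u ∈ K⁻¹ C K ∩ N`, a compact subset of `N` (`N` is closed), so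
`Λ(C) ≤ κ(K) · μ_N(K⁻¹ C K ∩ N) < ∞`. [cite: HarishChandra1999AdmissibleDistributions, §3 p. 9] -/
theorem isFiniteMeasureOnCompacts_map_conj_prod (κ : Measure ↥(glInt 3 F)) [IsFiniteMeasureOnCompacts κ]
    (μN : Measure ↥(unipotentRadicalGL F (id : Fin 3 → Fin 3))) [IsFiniteMeasureOnCompacts μN] [SFinite μN] :
    IsFiniteMeasureOnCompacts ((κ.prod μN).map fun q : ↥(glInt 3 F) × ↥(unipotentRadicalGL F (id : Fin 3 → Fin 3)) =>
      (q.1 : GL (Fin 3) F) * (q.2 : GL (Fin 3) F) * (q.1 : GL (Fin 3) F)⁻¹) := by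
  haveI : T2Space F := (isLocalField F).toT2Space
  haveI : LocallyCompactSpace F := (isLocalField F).toLocallyCompactSpace
  haveI : SecondCountableTopology F := secondCountableTopology_localField F
  haveI : T2Space (GL (Fin 3) F) := t2Space_generalLinearGroup F 3
  haveI : SecondCountableTopology (Matrix (Fin 3) (Fin 3) F) := inferInstanceAs (SecondCountableTopology (Fin 3 → Fin 3 → F))
  haveI : SecondCountableTopology (Matrix (Fin 3) (Fin 3) F)ᵐᵒᵖ := MulOpposite.opHomeomorph.symm.secondCountableTopology
  haveI : SecondCountableTopology (GL (Fin 3) F) := Units.isEmbedding_embedProduct.secondCountableTopology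
  haveI : SecondCountableTopology ↥(glInt 3 F) := TopologicalSpace.Subtype.secondCountableTopology _
  haveI : SecondCountableTopology ↥(unipotentRadicalGL F (id : Fin 3 → Fin 3)) := TopologicalSpace.Subtype.secondCountableTopology _
  haveI : BorelSpace ↥(glInt 3 F) := Subtype.borelSpace _
  haveI : BorelSpace ↥(unipotentRadicalGL F (id : Fin 3 → Fin 3)) := Subtype.borelSpace _
  haveI : BorelSpace (↥(glInt 3 F) × ↥(unipotentRadicalGL F (id : Fin 3 → Fin 3))) := Prod.borelSpace
  haveI : CompactSpace ↥(glInt 3 F) := isCompact_iff_compactSpace.1 (isCompact_glInt (n := 3) (F := F))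
  refine ⟨fun C hC => ?_⟩
  rw [Measure.map_apply (continuous_conj_prod F).measurable hC.measurableSet]
  -- `K⁻¹ C K` is compact in `G`, its trace on `N` is compact in `N`
  have hD : IsCompact ((fun t : GL (Fin 3) F × GL (Fin 3) F × GL (Fin 3) F => t.1 * t.2.1 * t.2.2) ''
      ((glInt 3 F : Set (GL (Fin 3) F)) ×ˢ C ×ˢ (glInt 3 F : Set (GL (Fin 3) F)))) :=
    ((isCompact_glInt (n := 3) (F := F)).prod (hC.prod (isCompact_glInt (n := 3) (F := F)))).image
      ((continuous_fst.mul (continuous_fst.comp continuous_snd)).mul (continuous_snd.comp continuous_snd))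
  have hT : IsCompact ((Subtype.val : ↥(unipotentRadicalGL F (id : Fin 3 → Fin 3)) → GL (Fin 3) F) ⁻¹'
      ((fun t : GL (Fin 3) F × GL (Fin 3) F × GL (Fin 3) F => t.1 * t.2.1 * t.2.2) ''
        ((glInt 3 F : Set (GL (Fin 3) F)) ×ˢ C ×ˢ (glInt 3 F : Set (GL (Fin 3) F))))) :=
    (isClosed_unipotentRadicalGL (R := F) (id : Fin 3 → Fin 3)).isClosedEmbedding_subtypeVal.isCompact_preimage hD
  refine lt_of_le_of_lt (measure_mono (fun q hq => ?_) ) ?_ (b := (κ.prod μN) (Set.univ ×ˢ ((Subtype.val :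
      ↥(unipotentRadicalGL F (id : Fin 3 → Fin 3)) → GL (Fin 3) F) ⁻¹' ((fun t : GL (Fin 3) F × GL (Fin 3) F × GL (Fin 3) F => t.1 * t.2.1 * t.2.2) ''
        ((glInt 3 F : Set (GL (Fin 3) F)) ×ˢ C ×ˢ (glInt 3 F : Set (GL (Fin 3) F)))))))
  · -- `u = k⁻¹ (k u k⁻¹) k`
    refine Set.mk_mem_prod (Set.mem_univ _) ?_
    refine ⟨((q.1 : GL (Fin 3) F)⁻¹, (q.1 : GL (Fin 3) F) * (q.2 : GL (Fin 3) F) * (q.1 : GL (Fin 3) F)⁻¹, (q.1 : GL (Fin 3) F)),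
      Set.mk_mem_prod (inv_mem q.1.2) (Set.mk_mem_prod hq q.1.2), by group⟩
  · rw [Measure.prod_prod]
    exact ENNReal.mul_lt_top (isCompact_univ.measure_lt_top) hT.measure_lt_top

omit [MeasurableSpace (GL (Fin 3) F)] [BorelSpace (GL (Fin 3) F)] in
/-- **Regular diagonal elements close to `1`**: every neighbourhood of `1 ∈ GL₃(F)` contains `γ = diag(1, 1 + a, 1 + a²)` with `0 < ‖a‖ < 1`, whose entries are
pairwise distinct (★ `exists_unitFiltration_subset`, ★ `exists_normAbs_eq_inv_zpow_of_int`). [cite: Rogawski1990, §8.1 p. 112] -/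
theorem exists_regular_glDiagonal_mem {W : Set (GL (Fin 3) F)} (hW : W ∈ 𝓝 (1 : GL (Fin 3) F)) :
    ∃ t : Fin 3 → Fˣ, (t 0 : F) ≠ t 1 ∧ (t 0 : F) ≠ t 2 ∧ (t 1 : F) ≠ t 2 ∧ glDiagonal 3 F t ∈ W := by
  haveI : IsTopologicalRing F := inferInstance
  -- the continuous family `(m₁, m₂) ↦ diag(1, m₁, m₂)` through `1`
  set ψ : Fˣ × Fˣ → GL (Fin 3) F := fun p => glDiagonal 3 F ![1, p.1, p.2] with hψ
  have hcont : Continuous ψ := by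
    refine (continuous_glDiagonal (n := 3) F).comp (continuous_pi fun i => ?_)
    fin_cases i
    · exact continuous_const
    · exact continuous_fst
    · exact continuous_snd
  have hψ1 : ψ 1 = 1 := by
    show glDiagonal 3 F ![1, (1 : Fˣ), (1 : Fˣ)] = 1
    have : (![1, (1 : Fˣ), (1 : Fˣ)] : Fin 3 → Fˣ) = 1 := by
      funext i; fin_cases i <;> rfl
    rw [this, map_one]
  have hpre : ψ ⁻¹' W ∈ 𝓝 ((1 : Fˣ), (1 : Fˣ)) :=
    hcont.continuousAt.preimage_mem_nhds (show W ∈ 𝓝 (ψ 1) by rw [hψ1]; exact hW)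
  obtain ⟨U₁, hU₁, U₂, hU₂, hUU⟩ := mem_nhds_prod_iff.1 hpre
  obtain ⟨r, hr, hsub⟩ := exists_unitFiltration_subset (Filter.inter_mem hU₁ hU₂)
  obtain ⟨a, ha0, ha⟩ := exists_normAbs_eq_inv_zpow_of_int (F := F) (r : ℤ)
  have hlt : normAbs F a < 1 := by
    rw [ha, zpow_natCast]
    exact pow_lt_one₀ inv_residueFieldCard_pos.le inv_residueFieldCard_lt_one (by omega)
  have h1a : (1 : F) + a ≠ 0 := by
    intro h
    have : a = -1 := by linear_combination h
    rw [this, normAbs_neg, map_one] at hlt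
    exact lt_irrefl _ hlt
  have h1a2 : (1 : F) + a ^ 2 ≠ 0 := by
    intro h
    have : a ^ 2 = -1 := by linear_combination h
    have h2 : normAbs F (a ^ 2) < 1 := by rw [map_pow]; exact pow_lt_one₀ zero_le hlt two_ne_zero
    rw [this, normAbs_neg, map_one] at h2
    exact lt_irrefl _ h2
  have hm₁ : Units.mk0 (1 + a) h1a ∈ unitFiltration F r :=
    (mem_unitFiltration_iff_sub_one_mem hr _).2 (by rw [Units.val_mk0, add_sub_cancel_left, mem_primePowBall_iff, ha])
  have hm₂ : Units.mk0 (1 + a ^ 2) h1a2 ∈ unitFiltration F r :=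
    (mem_unitFiltration_iff_sub_one_mem hr _).2 (by
      rw [Units.val_mk0, add_sub_cancel_left, mem_primePowBall_iff, map_pow, ha, zpow_natCast, ← pow_mul]
      exact pow_le_pow_of_le_one zero_le (inv_residueFieldCard_lt_one (F := F)).le (by omega))
  refine ⟨![1, Units.mk0 (1 + a) h1a, Units.mk0 (1 + a ^ 2) h1a2], ?_, ?_, ?_, hUU (Set.mk_mem_prod (hsub hm₁).1 (hsub hm₂).2)⟩
  · show ((1 : Fˣ) : F) ≠ ((Units.mk0 (1 + a) h1a : Fˣ) : F)
    rw [Units.val_one, Units.val_mk0]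
    intro h; exact ha0 (by linear_combination -h)
  · show ((1 : Fˣ) : F) ≠ ((Units.mk0 (1 + a ^ 2) h1a2 : Fˣ) : F)
    rw [Units.val_one, Units.val_mk0]
    intro h; exact ha0 (pow_eq_zero_iff two_ne_zero |>.1 (by linear_combination -h))
  · show ((Units.mk0 (1 + a) h1a : Fˣ) : F) ≠ ((Units.mk0 (1 + a ^ 2) h1a2 : Fˣ) : F)
    rw [Units.val_mk0, Units.val_mk0]
    intro h
    have h' : a * (1 - a) = 0 := by linear_combination h
    rcases mul_eq_zero.1 h' with h0 | h1
    · exact ha0 h0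
    · have : a = 1 := by linear_combination -h1
      rw [this, map_one] at hlt
      exact lt_irrefl _ hlt

omit [ValuativeRel F] [TopologicalSpace F] [IsNonarchimedeanLocalField F] [MeasurableSpace (GL (Fin 3) F)] [BorelSpace (GL (Fin 3) F)] in
/-- A diagonal element lies in the diagonal torus `A = M_{id}` and is centralised by it. [cite: BernsteinZelevinsky1977, §2.1] -/
theorem glDiagonal_comm_of_mem_standardLeviGL_id (t : Fin 3 → Fˣ) :
    ∀ a ∈ standardLeviGL F (id : Fin 3 → Fin 3), a * glDiagonal 3 F t = glDiagonal 3 F t * a := fun a ha =>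
  mul_comm_of_mem_standardLeviGL_id ha ((mem_standardLeviGL_id_iff _).2 fun i j hij => by
    rw [coe_glDiagonal]; exact Matrix.diagonal_apply_ne _ hij)

omit [TopologicalSpace F] [IsNonarchimedeanLocalField F] [BorelSpace (GL (Fin 3) F)] in
/-- **The average at `γ` equals the average at `1`**: `∫ Φ(k (u γ) k⁻¹) = ∫ Φ(k u k⁻¹)` as soon as `Φ(g v) = Φ g` for all `g` and all `v ∈ V` with `k γ k⁻¹ ∈ V` for
`k ∈ K` — `k (u γ) k⁻¹ = (k u k⁻¹)(k γ k⁻¹)` (the `ℝ≥0∞` twin of ★ `unipotentAverage_at_eq`). [cite: Rogawski1990, §8.1 p. 112] -/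
theorem lintegral_conj_mul_at_eq (κ : Measure ↥(glInt 3 F)) (μN : Measure ↥(unipotentRadicalGL F (id : Fin 3 → Fin 3))) {Φ : GL (Fin 3) F → ℝ≥0∞}
    {V : Set (GL (Fin 3) F)} (hΦV : ∀ g, ∀ v ∈ V, Φ (g * v) = Φ g) {γ : GL (Fin 3) F} (hγ : ∀ k : GL (Fin 3) F, k ∈ glInt 3 F → k * γ * k⁻¹ ∈ V) :
    ∫⁻ q : ↥(glInt 3 F) × ↥(unipotentRadicalGL F (id : Fin 3 → Fin 3)), Φ ((q.1 : GL (Fin 3) F) * ((q.2 : GL (Fin 3) F) * γ) * (q.1 : GL (Fin 3) F)⁻¹) ∂(κ.prod μN) =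
      ∫⁻ q : ↥(glInt 3 F) × ↥(unipotentRadicalGL F (id : Fin 3 → Fin 3)), Φ ((q.1 : GL (Fin 3) F) * (q.2 : GL (Fin 3) F) * (q.1 : GL (Fin 3) F)⁻¹) ∂(κ.prod μN) := by
  refine lintegral_congr fun q => ?_
  have h : (q.1 : GL (Fin 3) F) * ((q.2 : GL (Fin 3) F) * γ) * (q.1 : GL (Fin 3) F)⁻¹ =
      ((q.1 : GL (Fin 3) F) * (q.2 : GL (Fin 3) F) * (q.1 : GL (Fin 3) F)⁻¹) * ((q.1 : GL (Fin 3) F) * γ * (q.1 : GL (Fin 3) F)⁻¹) := by group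
  rw [h]
  exact hΦV _ _ (hγ _ q.1.2)

/-! ## §3  The Borel unipotent orbital measure is conjugation invariant -/

/-- **(R2-Borel), GROUP SIDE, AS A MEASURE: `(x g x⁻¹)_* Λ = Λ`** for `Λ = (k u k⁻¹)_*(κ ⊗ μ_N)` the Borel unipotent orbital measure of `GL₃(F)` (`κ`, `μ_N` Haar
measures on `K = GL₃(𝒪)` and on the upper unitriangular `N`) and every `x ∈ GL₃(F)` — the Deligne–Rao ∕ Richardson measure of the regular unipotent class is an
INVARIANT Radon measure.  Proof through ★ Rogawski's descent at a regular diagonal `γ` close to `1` and the invariance of the orbital integral over `G ⧸ A`.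
[cite: Rogawski1990, §4.13 Lemma 4.13.1 (a), proof p. 70; §8.1 p. 112] [cite: HarishChandra1999AdmissibleDistributions, §3 p. 9] -/
theorem GL3.map_conj_borelUnipotentMeasure_eq (κ : Measure ↥(glInt 3 F)) [IsHaarMeasure κ]
    (μN : Measure ↥(unipotentRadicalGL F (id : Fin 3 → Fin 3))) [IsHaarMeasure μN] (x : GL (Fin 3) F) :
    ((κ.prod μN).map fun q : ↥(glInt 3 F) × ↥(unipotentRadicalGL F (id : Fin 3 → Fin 3)) =>
        (q.1 : GL (Fin 3) F) * (q.2 : GL (Fin 3) F) * (q.1 : GL (Fin 3) F)⁻¹).map (fun g : GL (Fin 3) F => x * g * x⁻¹) =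
      (κ.prod μN).map fun q : ↥(glInt 3 F) × ↥(unipotentRadicalGL F (id : Fin 3 → Fin 3)) =>
        (q.1 : GL (Fin 3) F) * (q.2 : GL (Fin 3) F) * (q.1 : GL (Fin 3) F)⁻¹ := by
  classical
  -- topology and Borel structures
  haveI : T2Space F := (isLocalField F).toT2Space
  haveI : LocallyCompactSpace F := (isLocalField F).toLocallyCompactSpace
  haveI : SecondCountableTopology F := secondCountableTopology_localField F
  letI : MeasurableSpace F := borel F
  haveI : BorelSpace F := ⟨rfl⟩
  haveI : T2Space (GL (Fin 3) F) := t2Space_generalLinearGroup F 3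
  haveI : LocallyCompactSpace (GL (Fin 3) F) := locallyCompactSpace_generalLinearGroup F 3
  haveI : SecondCountableTopology (Matrix (Fin 3) (Fin 3) F) := inferInstanceAs (SecondCountableTopology (Fin 3 → Fin 3 → F))
  haveI : SecondCountableTopology (Matrix (Fin 3) (Fin 3) F)ᵐᵒᵖ := MulOpposite.opHomeomorph.symm.secondCountableTopology
  haveI : SecondCountableTopology (GL (Fin 3) F) := Units.isEmbedding_embedProduct.secondCountableTopology
  haveI : NonarchimedeanGroup (GL (Fin 3) F) := nonarchimedeanGroup_gl F 3
  haveI : SecondCountableTopology ↥(glInt 3 F) := TopologicalSpace.Subtype.secondCountableTopology _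
  haveI : SecondCountableTopology ↥(unipotentRadicalGL F (id : Fin 3 → Fin 3)) := TopologicalSpace.Subtype.secondCountableTopology _
  haveI : BorelSpace ↥(glInt 3 F) := Subtype.borelSpace _
  haveI : BorelSpace ↥(unipotentRadicalGL F (id : Fin 3 → Fin 3)) := Subtype.borelSpace _
  haveI : LocallyCompactSpace ↥(unipotentRadicalGL F (id : Fin 3 → Fin 3)) := (isClosed_unipotentRadicalGL (R := F) (id : Fin 3 → Fin 3)).locallyCompactSpace
  haveI : SFinite μN := inferInstance
  haveI : BorelSpace (↥(glInt 3 F) × ↥(unipotentRadicalGL F (id : Fin 3 → Fin 3))) := Prod.borelSpace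
  haveI : CompactSpace ↥(glInt 3 F) := isCompact_iff_compactSpace.1 (isCompact_glInt (n := 3) (F := F))
  haveI : IsFiniteMeasure κ := CompactSpace.isFiniteMeasure
  -- the two measures; both finite on compacta
  have hΦm : Measurable fun q : ↥(glInt 3 F) × ↥(unipotentRadicalGL F (id : Fin 3 → Fin 3)) =>
      (q.1 : GL (Fin 3) F) * (q.2 : GL (Fin 3) F) * (q.1 : GL (Fin 3) F)⁻¹ := (continuous_conj_prod F).measurable
  have hcx : Continuous fun g : GL (Fin 3) F => x * g * x⁻¹ := (continuous_const.mul continuous_id).mul continuous_const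
  haveI hfin := isFiniteMeasureOnCompacts_map_conj_prod F κ μN
  haveI : IsFiniteMeasureOnCompacts (((κ.prod μN).map fun q : ↥(glInt 3 F) × ↥(unipotentRadicalGL F (id : Fin 3 → Fin 3)) =>
      (q.1 : GL (Fin 3) F) * (q.2 : GL (Fin 3) F) * (q.1 : GL (Fin 3) F)⁻¹).map (fun g : GL (Fin 3) F => x * g * x⁻¹)) := by
    refine ⟨fun C hC => ?_⟩
    rw [Measure.map_apply hcx.measurable hC.measurableSet]
    have hC' : IsCompact ((fun g : GL (Fin 3) F => x * g * x⁻¹) ⁻¹' C) := by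
      have he : (fun g : GL (Fin 3) F => x * g * x⁻¹) ⁻¹' C = (fun g : GL (Fin 3) F => x⁻¹ * g * x) '' C := by
        ext g; constructor
        · intro hg; exact ⟨x * g * x⁻¹, hg, by group⟩
        · rintro ⟨h, hh, rfl⟩; show x * (x⁻¹ * h * x) * x⁻¹ ∈ C; rwa [show x * (x⁻¹ * h * x) * x⁻¹ = h by group]
      rw [he]; exact hC.image ((continuous_const.mul continuous_id).mul continuous_const)
    exact hC'.measure_lt_top
  -- the invariant Radon measure on `G ⧸ A`, `A` the diagonal torus, and Rogawski's descent constant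
  set A : Subgroup (GL (Fin 3) F) := standardLeviGL F (id : Fin 3 → Fin 3) with hA
  have hAcl : IsClosed ((A : Subgroup (GL (Fin 3) F)) : Set (GL (Fin 3) F)) := isClosed_standardLeviGL (R := F) (id : Fin 3 → Fin 3)
  letI : MeasurableSpace (GL (Fin 3) F ⧸ A) := borel _
  haveI : BorelSpace (GL (Fin 3) F ⧸ A) := ⟨rfl⟩
  haveI : BorelSpace ↥A := Subtype.borelSpace _
  haveI : LocallyCompactSpace ↥A := hAcl.locallyCompactSpace
  haveI : SecondCountableTopology ↥A := TopologicalSpace.Subtype.secondCountableTopology _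
  haveI : (haar : Measure ↥A).IsInvInvariant := isInvInvariant_haar_standardLeviGL F (id : Fin 3 → Fin 3) haar
  haveI : (haar : Measure (GL (Fin 3) F)).IsMulRightInvariant := isMulRightInvariant_generalLinearGroup _
  obtain ⟨μq, hμinv, hμreg, hμ0, -⟩ :=
    exists_smulInvariantMeasure_integral_fiberIntegral_eq A (haar : Measure ↥A) hAcl (haar : Measure (GL (Fin 3) F))
  haveI := hμinv
  haveI := hμreg
  obtain ⟨C, hC0, hCtop, hdesc⟩ := exists_lintegral_descConj_diagonal_eq_mul F hA μq hμ0 κ μN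
  -- compare on compact open sets
  refine measure_ext_of_isCompact_isOpen isTopologicalBasis_setOf_isCompact_isOpen _ _ fun S hSc hSo => ?_
  have hS'c : IsCompact ((fun g : GL (Fin 3) F => x * g * x⁻¹) ⁻¹' S) := by
    have he : (fun g : GL (Fin 3) F => x * g * x⁻¹) ⁻¹' S = (fun g : GL (Fin 3) F => x⁻¹ * g * x) '' S := by
      ext g; constructor
      · intro hg; exact ⟨x * g * x⁻¹, hg, by group⟩
      · rintro ⟨h, hh, rfl⟩; show x * (x⁻¹ * h * x) * x⁻¹ ∈ S; rwa [show x * (x⁻¹ * h * x) * x⁻¹ = h by group]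
    rw [he]; exact hSc.image ((continuous_const.mul continuous_id).mul continuous_const)
  have hS'o : IsOpen ((fun g : GL (Fin 3) F => x * g * x⁻¹) ⁻¹' S) := hSo.preimage hcx
  rw [Measure.map_apply hcx.measurable hSo.measurableSet, Measure.map_apply hΦm (hSo.measurableSet.preimage hcx.measurable), Measure.map_apply hΦm hSo.measurableSet]
  -- §1: right-invariance neighbourhoods of `𝟙_S`, `𝟙_{x⁻¹ S x}`; the tube `W`; a regular diagonal `γ ∈ W`
  obtain ⟨V₁, hV₁, hSV₁⟩ := exists_nhds_one_forall_mul_mem_iff hSc hSo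
  obtain ⟨V₂, hV₂, hSV₂⟩ := exists_nhds_one_forall_mul_mem_iff hS'c hS'o
  obtain ⟨W, hW, hWV⟩ := exists_nhds_one_forall_conj_mem (G := GL (Fin 3) F) (isCompact_glInt (n := 3) (F := F)) (Filter.inter_mem hV₁ hV₂)
  obtain ⟨t, h01, h02, h12, htW⟩ := exists_regular_glDiagonal_mem F hW
  have hγ₁ : ∀ k : GL (Fin 3) F, k ∈ glInt 3 F → k * glDiagonal 3 F t * k⁻¹ ∈ V₁ := fun k hk => (hWV _ htW k hk).1
  have hγ₂ : ∀ k : GL (Fin 3) F, k ∈ glInt 3 F → k * glDiagonal 3 F t * k⁻¹ ∈ V₂ := fun k hk => (hWV _ htW k hk).2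
  have hγA := glDiagonal_comm_of_mem_standardLeviGL_id F t
  -- the two preimage masses as averages of indicators, then as averages at `γ`
  have hmeas₁ : Measurable (S.indicator (1 : GL (Fin 3) F → ℝ≥0∞)) := measurable_one.indicator hSo.measurableSet
  have hmeas₂ : Measurable (((fun g : GL (Fin 3) F => x * g * x⁻¹) ⁻¹' S).indicator (1 : GL (Fin 3) F → ℝ≥0∞)) :=
    measurable_one.indicator (hSo.measurableSet.preimage hcx.measurable)
  have e₁ : (κ.prod μN) ((fun q : ↥(glInt 3 F) × ↥(unipotentRadicalGL F (id : Fin 3 → Fin 3)) =>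
      (q.1 : GL (Fin 3) F) * (q.2 : GL (Fin 3) F) * (q.1 : GL (Fin 3) F)⁻¹) ⁻¹' S) =
      ∫⁻ q : ↥(glInt 3 F) × ↥(unipotentRadicalGL F (id : Fin 3 → Fin 3)),
        S.indicator (1 : GL (Fin 3) F → ℝ≥0∞) ((q.1 : GL (Fin 3) F) * ((q.2 : GL (Fin 3) F) * glDiagonal 3 F t) * (q.1 : GL (Fin 3) F)⁻¹) ∂(κ.prod μN) := by
    rw [lintegral_conj_mul_at_eq F κ μN (fun g v hv => indicator_mul_eq_of_forall_mul_mem_iff hSV₁ g hv) hγ₁,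
      ← lintegral_indicator_one (hSo.measurableSet.preimage hΦm)]
    rfl
  have e₂ : (κ.prod μN) ((fun q : ↥(glInt 3 F) × ↥(unipotentRadicalGL F (id : Fin 3 → Fin 3)) =>
      (q.1 : GL (Fin 3) F) * (q.2 : GL (Fin 3) F) * (q.1 : GL (Fin 3) F)⁻¹) ⁻¹' ((fun g : GL (Fin 3) F => x * g * x⁻¹) ⁻¹' S)) =
      ∫⁻ q : ↥(glInt 3 F) × ↥(unipotentRadicalGL F (id : Fin 3 → Fin 3)),
        ((fun g : GL (Fin 3) F => x * g * x⁻¹) ⁻¹' S).indicator (1 : GL (Fin 3) F → ℝ≥0∞)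
          ((q.1 : GL (Fin 3) F) * ((q.2 : GL (Fin 3) F) * glDiagonal 3 F t) * (q.1 : GL (Fin 3) F)⁻¹) ∂(κ.prod μN) := by
    rw [lintegral_conj_mul_at_eq F κ μN (fun g v hv => indicator_mul_eq_of_forall_mul_mem_iff hSV₂ g hv) hγ₂,
      ← lintegral_indicator_one ((hSo.measurableSet.preimage hcx.measurable).preimage hΦm)]
    rfl
  -- Rogawski's descent at `γ` for both indicators
  have d₁ := hdesc t h01 h02 h12 hγA _ hmeas₁
  have d₂ := hdesc t h01 h02 h12 hγA _ hmeas₂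
  -- invariance of the orbital integral over `G ⧸ A` under `S ↦ x⁻¹ S x`
  have hinv : ∫⁻ y, descConj (glDiagonal 3 F t) A hγA (((fun g : GL (Fin 3) F => x * g * x⁻¹) ⁻¹' S).indicator (1 : GL (Fin 3) F → ℝ≥0∞)) y ∂μq =
      ∫⁻ y, descConj (glDiagonal 3 F t) A hγA (S.indicator (1 : GL (Fin 3) F → ℝ≥0∞)) y ∂μq := by
    have h1 : ∀ y, descConj (glDiagonal 3 F t) A hγA (((fun g : GL (Fin 3) F => x * g * x⁻¹) ⁻¹' S).indicator (1 : GL (Fin 3) F → ℝ≥0∞)) y =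
        descConj (glDiagonal 3 F t) A hγA (S.indicator (1 : GL (Fin 3) F → ℝ≥0∞)) (x • y) := fun y => by
      induction y using QuotientGroup.induction_on with
      | H g =>
        rw [MulAction.Quotient.smul_mk, descConj_mk, descConj_mk, smul_eq_mul,
          show ((fun g : GL (Fin 3) F => x * g * x⁻¹) ⁻¹' S).indicator (1 : GL (Fin 3) F → ℝ≥0∞) =
            ((fun g : GL (Fin 3) F => x * g * x⁻¹) ⁻¹' S).indicator ((1 : GL (Fin 3) F → ℝ≥0∞) ∘ fun g : GL (Fin 3) F => x * g * x⁻¹) from rfl,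
          Set.indicator_comp_right]
        congr 1
        group
    simp_rw [h1]
    have hsm : map (fun y : GL (Fin 3) F ⧸ A => x • y) μq = μq := MeasureTheory.map_smul (μ := μq) x
    have hdm : Measurable (descConj (glDiagonal 3 F t) A hγA (S.indicator (1 : GL (Fin 3) F → ℝ≥0∞))) := measurable_descConj _ _ _ hmeas₁
    conv_rhs => rw [← hsm]
    rw [lintegral_map hdm (measurable_const_smul x)]
  have key := d₂.symm.trans (hinv.trans d₁)
  -- cancel the non-zero finite scalar `C · ‖Δ(γ)‖⁻¹`
  have hX : (1 - (t 0 : F) * (t 1 : F)⁻¹) * ((1 - (t 0 : F) * (t 2 : F)⁻¹) * (1 - (t 1 : F) * (t 2 : F)⁻¹)) ≠ 0 := by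
    have hne : ∀ {a b : Fˣ}, (a : F) ≠ b → (1 : F) - (a : F) * (b : F)⁻¹ ≠ 0 := fun {a b} hab => by
      rw [sub_ne_zero]
      intro h
      apply hab
      have := congrArg (fun y : F => y * (b : F)) h
      simp only [one_mul, inv_mul_cancel_right₀ (Units.ne_zero b)] at this
      exact this.symm
    exact mul_ne_zero (hne h01) (mul_ne_zero (hne h02) (hne h12))
  have hcancel : ∀ {a b c : ℝ≥0∞}, a ≠ 0 → a ≠ ∞ → a * b = a * c → b = c := fun ha ht h => (ENNReal.mul_right_inj ha ht).1 h
  have hfinal := hcancel (mul_ne_zero hC0 (ENNReal.coe_ne_zero.2 ((map_ne_zero (normAbs F)).2 (inv_ne_zero hX))))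
    (ENNReal.mul_ne_top hCtop ENNReal.coe_ne_top) key
  rw [e₂, e₁]
  exact hfinal

end GL3

end Summit.HodgeConjecture.HodgeConjecture.Cruxes.H413.K2E3GL3BorelUnipotentMeasureConjInvariant

end
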